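import Summits.AtomisticToContinuum.Crystallization.Theorems.ChartedPlanarOrderHeightFloorB
import Summits.AtomisticToContinuum.Crystallization.Theorems.ChartedPlanarOrderLatticeSmear
import Summits.AtomisticToContinuum.Crystallization.Theorems.ChartedPlanarOrderTubeChannelsTS
import Mathlib.Analysis.Real.Pi.Bounds

/-!
# The sharp pair-modulus tail: `PairModulusTailRef (17/16) (1/40) s₀ B₂(s₀)` with a SMALL explicit budget (decomp-a2c lens-3 g25)

The tail leaf of record `…TubeChannelsRef.PairModulusTailRef Λ₁ ρ s₀ B₂` (Lipschitz span moduli `τ` of the layer-pair forces along the `ρ`-tube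
with `Σ_{s₀ ≤ s < N} s² τ_s ≤ B₂`) was proved in `…PairModulusTail` with the crude uniform constant `tailConst ρ ≈ 4·10¹⁰` (floor `19/50`, product
of line sums), i.e. `B₂(s₀) = tailConst/(3(s₀−1)³)` — useless below `s₀ ≈ 2000`.  This file proves the SAME leaf with

  `B₂(s₀) = sharpConst g θ ρ R_c ε s₀ / (3 (s₀ − 1)³)`,  e.g. `B₂(7) ≤ 6/5`, `B₂(9) ≤ 43/100`, `B₂(12) ≤ 3/20` (uniform), and at configuration
  level in the near-triangular branch (floor `73/100`) `B₂ᵀ(9) ≤ 7/50`,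

from three inputs: (1) the HEIGHT FLOOR of `…HeightFloor` (`⟪ν, incr w i⟫ ≥ 33a′/50` on every uniformly clean stacked configuration, `≥ 39a′/50`
near-triangular; `a′ ≥ 47/50`), replacing `19/50`; (2) the SMEARED lattice sum of `…LatticeSmear` against the exact Gram form (continuum value
`π/((n−1)√G T₂ⁿ⁻¹)` instead of the product of two line sums); (3) a PIECEWISE modulus — the crude `(v)` modulus `spanConst·s⁻⁶` below `s₀` (not
budgeted by the leaf) and the sharp far-field modulus `sharpConst·s⁻⁶` from `s₀` on, where the planar discrepancy `‖v−v′‖ ≤ 2ρs` and the cell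
radius `R_c` are absorbed into `T₂(s) ≥ s²Θ₂`, `Θ₂ = (1+ε)θ² − (1+1/ε)(2ρ + R_c/s₀)²`, `θ = floor − ρ`.

Main results: `norm_layerForce_sub_le_smear` (§1, per layer pair), `isPairModulus_sharp` (§3, configuration level, any floor), ★★★
`pairModulusTailRef_sharp` / `pairModulusTailRef_record₇|₉|₁₂` / `exists_tail_record₉T` (§4, the leaf at `(17/16, 1/40)`), the consumer
forms `tubeConvexRef_record_of_certs_sharp` / `tubeConvexRef_record_of_certs₉` (§5, slot 7c‴ from the two uniform certificate leaves with the
sharp budget), and the PER-BRANCH consumer `tubeChannelsRef_of_branch_certs_sharp` / `tubeConvexRef_record_of_branch_certs_sharp|₆` (§6, the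
T/S twin leaves of `…TubeChannelsTS` with floor `73/100` on the triangular branch: budgets `7/10` (T) and `9/4` (S) at `s₀ = 6`).
Sorry-free, standard axioms, no instances, no notation.
-/

noncomputable section

namespace Summit.AtomisticToContinuum.Crystallization.Theorems.ChartedPlanarOrderPairModulusSharp

open Finset Metric Real
open scoped RealInnerProductSpace
open Summit.AtomisticToContinuum.Crystallization.Theorems.ChartedPlanarOrderRigidityDoor (E3)
open Summit.AtomisticToContinuum.Crystallization.Theorems.ChartedPlanarOrderDensityDichotomy (IsSep μS)
open Summit.AtomisticToContinuum.Crystallization.Theorems.ChartedPlanarOrderDoorLayered (Layered)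
open Summit.AtomisticToContinuum.Crystallization.Theorems.ChartedPlanarOrderProfileSlavingLJ (pairForce layerForce incr offsetOf tube
  IsStacked gapStress)
open Summit.AtomisticToContinuum.Crystallization.Theorems.ChartedPlanarOrderLayerForceLipschitz (le_inner_offsetOf
  norm_layerForce_sub_le_of_floor)
open Summit.AtomisticToContinuum.Crystallization.Theorems.ChartedPlanarOrderLayerFrame (norm_sq_add_smul_normal norm_sq_eq_planar_add_height)
open Summit.AtomisticToContinuum.Crystallization.Theorems.ChartedPlanarOrderStackedLayerGeometry (inner_period_combo)
open Summit.AtomisticToContinuum.Crystallization.Theorems.ChartedPlanarOrderTubeMonotoneSplit (IsPairModulus norm_offsetOf_sub_le)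
open Summit.AtomisticToContinuum.Crystallization.Theorems.ChartedPlanarOrderPairModulus (modulus modulus_nonneg pairForce_sub_le_modulus gram_pos
  qA qB exists_planar summable_layer spanConst spanConst_nonneg isPairModulus_of_heightFloor)
open Summit.AtomisticToContinuum.Crystallization.Theorems.ChartedPlanarOrderTubeConvex (TubeConvexRef)
open Summit.AtomisticToContinuum.Crystallization.Theorems.ChartedPlanarOrderTubeChannelsRef (AdjacentChannelRef FarChannelBelowRef
  PairModulusTailRef tubeConvexRef_record_of_leaves TubeChannelsRef tubeConvexRef_record_of_channels)
open Summit.AtomisticToContinuum.Crystallization.Theorems.ChartedPlanarOrderTubeChannels (tubeChannelData_of_certs)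
open Summit.AtomisticToContinuum.Crystallization.Theorems.ChartedPlanarOrderTubeChannelsTS (AdjacentChannelRefT AdjacentChannelRefS
  FarChannelBelowRefT FarChannelBelowRefS)
open Summit.AtomisticToContinuum.Crystallization.Theorems.ChartedPlanarOrderStackedUniform (stackedUniform)
open Summit.AtomisticToContinuum.Crystallization.Theorems.ChartedPlanarOrderPairModulusTail (sum_Ico_sq_mul_power_le)
open Summit.AtomisticToContinuum.Crystallization.Theorems.OverbindingBudgetPeriodicCleanOrStrained (UniformlyClean)
open Summit.AtomisticToContinuum.Crystallization.Theorems.OverbindingBudgetScaleWidening (IsCleanW)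
open Summit.AtomisticToContinuum.Crystallization.Theorems.ChartedPlanarOrderHeightFloor (cleanStackedWindows)
open Summit.AtomisticToContinuum.Crystallization.Theorems.ChartedPlanarOrderLatticeSmear (tsum_modulus_le_smear norm_sq_lin)

/-! ## §1 The far-field layer-force Lipschitz bound with the smeared constant -/

/-- ★★ PER LAYER PAIR: for independent planar periods `a, b ⊥ ν`, heights `|⟪ν,v⟩|, |⟪ν,v′⟩| ≥ t > 0`, planar-cell radius `R_c`, `ε > 0`
and `‖v − v′‖ ≤ d` with `T₂ = (1+ε)t² − (1+1/ε)(d+R_c)² > 0`: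
`‖F_{a,b}(v) − F_{a,b}(v′)‖ ≤ (π/√G)·[15(1+ε)⁷/(6T₂⁶) + 9(1+ε)⁴/(3T₂³)]·‖v − v′‖`. -/
theorem norm_layerForce_sub_le_smear {ν a b v v' : E3} (hν : ‖ν‖ = 1) (hνa : ⟪ν, a⟫ = 0) (hνb : ⟪ν, b⟫ = 0)
    (hab : LinearIndependent ℝ ![a, b]) {t d Rc ε : ℝ} (ht : 0 < t) (hε : 0 < ε)
    (hRc : ∀ ζ₁ ζ₂ : ℝ, |ζ₁| ≤ 1 / 2 → |ζ₂| ≤ 1 / 2 → ‖ζ₁ • a + ζ₂ • b‖ ≤ Rc)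
    (hT : 0 < (1 + ε) * t ^ 2 - (1 + ε⁻¹) * (d + Rc) ^ 2)
    (htv : t ^ 2 ≤ ⟪ν, v⟫ ^ 2) (htv' : t ^ 2 ≤ ⟪ν, v'⟫ ^ 2) (hvv' : ‖v - v'‖ ≤ d) :
    ‖layerForce a b v - layerForce a b v'‖ ≤
      π / Real.sqrt (‖a‖ ^ 2 * ‖b‖ ^ 2 - ⟪a, b⟫ ^ 2) *
          (15 * (1 + ε) ^ 7 / (6 * ((1 + ε) * t ^ 2 - (1 + ε⁻¹) * (d + Rc) ^ 2) ^ 6) +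
            9 * (1 + ε) ^ 4 / (3 * ((1 + ε) * t ^ 2 - (1 + ε⁻¹) * (d + Rc) ^ 2) ^ 3)) * ‖v - v'‖ := by
  obtain ⟨c₁, c₂, hc⟩ := exists_planar hab hν hνa hνb v
  obtain ⟨c₁', c₂', hc'⟩ := exists_planar hab hν hνa hνb v'
  have hd : 0 ≤ d := (norm_nonneg _).trans hvv'
  -- planar parts of the sites
  set P : ℤ × ℤ → E3 := fun ij => ((ij.1 : ℝ) + c₁) • a + ((ij.2 : ℝ) + c₂) • b with hP
  set P' : ℤ × ℤ → E3 := fun ij => ((ij.1 : ℝ) + c₁') • a + ((ij.2 : ℝ) + c₂') • b with hP'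
  have hPν : ∀ ij, ⟪ν, P ij⟫ = 0 := fun ij => inner_period_combo hνa hνb _ _
  have hP'ν : ∀ ij, ⟪ν, P' ij⟫ = 0 := fun ij => inner_period_combo hνa hνb _ _
  have hsite : ∀ ij : ℤ × ℤ, v + ((ij.1 : ℝ) • a + (ij.2 : ℝ) • b) = P ij + ⟪ν, v⟫ • ν := by
    intro ij
    have hv : v = c₁ • a + c₂ • b + ⟪ν, v⟫ • ν := by rw [← hc, sub_add_cancel]
    rw [hP]; dsimp only
    rw [hv, inner_add_right, inner_period_combo hνa hνb, zero_add, real_inner_smul_right, real_inner_self_eq_norm_sq, hν]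
    module
  have hsite' : ∀ ij : ℤ × ℤ, v' + ((ij.1 : ℝ) • a + (ij.2 : ℝ) • b) = P' ij + ⟪ν, v'⟫ • ν := by
    intro ij
    have hv : v' = c₁' • a + c₂' • b + ⟪ν, v'⟫ • ν := by rw [← hc', sub_add_cancel]
    rw [hP']; dsimp only
    rw [hv, inner_add_right, inner_period_combo hνa hνb, zero_add, real_inner_smul_right, real_inner_self_eq_norm_sq, hν]
    module
  have hnsq : ∀ ij : ℤ × ℤ, ‖v + ((ij.1 : ℝ) • a + (ij.2 : ℝ) • b)‖ ^ 2 = ‖P ij‖ ^ 2 + ⟪ν, v⟫ ^ 2 := fun ij => by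
    rw [hsite, norm_sq_add_smul_normal hν (hPν ij)]
  have hnsq' : ∀ ij : ℤ × ℤ, ‖v' + ((ij.1 : ℝ) • a + (ij.2 : ℝ) • b)‖ ^ 2 = ‖P' ij‖ ^ 2 + ⟪ν, v'⟫ ^ 2 := fun ij => by
    rw [hsite', norm_sq_add_smul_normal hν (hP'ν ij)]
  -- the planar parts differ by at most `‖v − v′‖ ≤ d`
  have hPP' : ∀ ij, ‖P ij - P' ij‖ ≤ d := by
    intro ij
    have e : P ij - P' ij = (v - v') - ⟪ν, v - v'⟫ • ν := by
      have e1 : P ij - P' ij = (c₁ • a + c₂ • b) - (c₁' • a + c₂' • b) := by rw [hP, hP']; dsimp only; module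
      rw [e1, ← hc, ← hc', inner_sub_right, sub_smul]; abel
    have h2 := (norm_sq_eq_planar_add_height hν (v - v')).2
    have h3 : ‖P ij - P' ij‖ ^ 2 ≤ ‖v - v'‖ ^ 2 := by rw [e]; nlinarith [sq_nonneg ⟪ν, v - v'⟫]
    exact ((pow_le_pow_iff_left₀ (norm_nonneg _) (norm_nonneg _) two_ne_zero).1 h3).trans hvv'
  -- common floors `r_ij = √(t² + m_ij²)`, `m_ij = max (‖P_ij‖ − d) 0`
  have hr : ∀ ij : ℤ × ℤ, 0 < Real.sqrt (t ^ 2 + (max (‖P ij‖ - d) 0) ^ 2) := fun ij => Real.sqrt_pos.2 (by positivity)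
  have hrv : ∀ ij : ℤ × ℤ, Real.sqrt (t ^ 2 + (max (‖P ij‖ - d) 0) ^ 2) ≤ ‖v + ((ij.1 : ℝ) • a + (ij.2 : ℝ) • b)‖ := by
    intro ij
    have h1 : max (‖P ij‖ - d) 0 ≤ ‖P ij‖ := max_le (by linarith) (norm_nonneg _)
    have h2 : (max (‖P ij‖ - d) 0) ^ 2 ≤ ‖P ij‖ ^ 2 := pow_le_pow_left₀ (le_max_right _ _) h1 2
    calc Real.sqrt (t ^ 2 + (max (‖P ij‖ - d) 0) ^ 2) ≤ Real.sqrt (‖v + ((ij.1 : ℝ) • a + (ij.2 : ℝ) • b)‖ ^ 2) :=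
          Real.sqrt_le_sqrt (by rw [hnsq ij]; linarith)
      _ = _ := Real.sqrt_sq (norm_nonneg _)
  have hrv' : ∀ ij : ℤ × ℤ, Real.sqrt (t ^ 2 + (max (‖P ij‖ - d) 0) ^ 2) ≤ ‖v' + ((ij.1 : ℝ) • a + (ij.2 : ℝ) • b)‖ := by
    intro ij
    have h1 : max (‖P ij‖ - d) 0 ≤ ‖P' ij‖ := max_le (by linarith [norm_sub_norm_le (P ij) (P' ij), hPP' ij]) (norm_nonneg _)
    have h2 : (max (‖P ij‖ - d) 0) ^ 2 ≤ ‖P' ij‖ ^ 2 := pow_le_pow_left₀ (le_max_right _ _) h1 2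
    calc Real.sqrt (t ^ 2 + (max (‖P ij‖ - d) 0) ^ 2) ≤ Real.sqrt (‖v' + ((ij.1 : ℝ) • a + (ij.2 : ℝ) • b)‖ ^ 2) :=
          Real.sqrt_le_sqrt (by rw [hnsq' ij]; linarith)
      _ = _ := Real.sqrt_sq (norm_nonneg _)
  -- the smeared lattice sum and the summabilities
  obtain ⟨hμ, hle⟩ := tsum_modulus_le_smear hab hε hRc hT c₁ c₂ (m := fun ij => max (‖P ij‖ - d) 0)
    (fun ij => by show ‖P ij‖ ≤ max (‖P ij‖ - d) 0 + d; linarith [le_max_left (‖P ij‖ - d) 0])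
  have hv := summable_layer hν hνa hνb hab ht htv
  have hv' := summable_layer hν hνa hνb hab ht htv'
  have key := norm_layerForce_sub_le_of_floor (r := fun ij => Real.sqrt (t ^ 2 + (max (‖P ij‖ - d) 0) ^ 2)) (Φ := modulus)
    (fun hs hx hy => pairForce_sub_le_modulus hs hx hy) hr hrv hrv' hμ hv hv'
  exact key.trans (mul_le_mul_of_nonneg_right hle (norm_nonneg _))

/-! ## §2 The sharp power constant: `T₂(s) ≥ s² Θ₂` and `τ_s ≤ sharpConst · s⁻⁶` from `s₀` on -/

/-- `Θ₂ := (1+ε)θ² − (1+1/ε)(2ρ + R_c/s₀)²` — the rescaled worst `T₂/s²` from span `s₀` on. -/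
def thetaSq (θ ρ Rc ε s₀ : ℝ) : ℝ := (1 + ε) * θ ^ 2 - (1 + ε⁻¹) * (2 * ρ + Rc / s₀) ^ 2

/-- ★ the SHARP POWER CONSTANT `K = (π/g)·[15(1+ε)⁷/(6 Θ₂⁶ s₀⁶) + 9(1+ε)⁴/(3 Θ₂³)]` (`g ≤ √G` a Gram floor): `τ_s ≤ K s⁻⁶` for `s ≥ s₀`. -/
def sharpConst (g θ ρ Rc ε s₀ : ℝ) : ℝ :=
  π / g * (15 * (1 + ε) ^ 7 / (6 * thetaSq θ ρ Rc ε s₀ ^ 6 * s₀ ^ 6) + 9 * (1 + ε) ^ 4 / (3 * thetaSq θ ρ Rc ε s₀ ^ 3))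

/-- `0 ≤ sharpConst`. [folklore] -/
theorem sharpConst_nonneg {g θ ρ Rc ε s₀ : ℝ} (hg : 0 < g) (hε : 0 < ε) (hs₀ : 0 < s₀) (hΘ : 0 < thetaSq θ ρ Rc ε s₀) :
    0 ≤ sharpConst g θ ρ Rc ε s₀ := by
  unfold sharpConst; positivity

/-- `s² Θ₂ ≤ T₂ = (1+ε)t² − (1+1/ε)(d + R_c)²` when `t ≥ sθ ≥ 0`, `0 ≤ d ≤ 2ρs`, `s ≥ s₀ > 0`. -/
theorem sq_mul_thetaSq_le {θ ρ Rc ε s₀ s t d : ℝ} (hε : 0 < ε) (hθ : 0 ≤ θ) (hρ : 0 ≤ ρ) (hRc : 0 ≤ Rc) (hs₀ : 0 < s₀)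
    (hs : s₀ ≤ s) (hts : s * θ ≤ t) (hd0 : 0 ≤ d) (hd : d ≤ 2 * ρ * s) :
    s ^ 2 * thetaSq θ ρ Rc ε s₀ ≤ (1 + ε) * t ^ 2 - (1 + ε⁻¹) * (d + Rc) ^ 2 := by
  have hs0 : 0 < s := lt_of_lt_of_le hs₀ hs
  have h1 : (s * θ) ^ 2 ≤ t ^ 2 := pow_le_pow_left₀ (by positivity) hts 2
  have h2 : (d + Rc) ^ 2 ≤ (2 * ρ * s + Rc) ^ 2 := pow_le_pow_left₀ (by positivity) (by linarith) 2
  have h3 : Rc / s ≤ Rc / s₀ := div_le_div_of_nonneg_left hRc hs₀ hs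
  have h4 : (2 * ρ + Rc / s) ^ 2 ≤ (2 * ρ + Rc / s₀) ^ 2 := pow_le_pow_left₀ (by positivity) (by linarith) 2
  have e1 : (2 * ρ * s + Rc) ^ 2 = s ^ 2 * (2 * ρ + Rc / s) ^ 2 := by field_simp
  have h5 : (d + Rc) ^ 2 ≤ s ^ 2 * (2 * ρ + Rc / s₀) ^ 2 :=
    h2.trans (by rw [e1]; exact mul_le_mul_of_nonneg_left h4 (by positivity))
  have hε1 : (0:ℝ) ≤ 1 + ε := by positivity
  have hε2 : (0:ℝ) ≤ 1 + ε⁻¹ := by positivity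
  have e2 : s ^ 2 * thetaSq θ ρ Rc ε s₀ = (1 + ε) * (s * θ) ^ 2 - (1 + ε⁻¹) * (s ^ 2 * (2 * ρ + Rc / s₀) ^ 2) := by
    unfold thetaSq; ring
  rw [e2]
  nlinarith [mul_le_mul_of_nonneg_left h1 hε1, mul_le_mul_of_nonneg_left h5 hε2]

/-- ★ the smeared constant is at most `sharpConst · s⁻⁶` for `s ≥ s₀` (`g ≤ √G`, `s²Θ₂ ≤ T₂`). -/
theorem smear_le_sharpConst {sG g θ ρ Rc ε s₀ s T2 : ℝ} (hg : 0 < g) (hgs : g ≤ sG) (hε : 0 < ε) (hs₀ : 0 < s₀) (hs : s₀ ≤ s)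
    (hΘ : 0 < thetaSq θ ρ Rc ε s₀) (hT2 : s ^ 2 * thetaSq θ ρ Rc ε s₀ ≤ T2) :
    π / sG * (15 * (1 + ε) ^ 7 / (6 * T2 ^ 6) + 9 * (1 + ε) ^ 4 / (3 * T2 ^ 3)) ≤ sharpConst g θ ρ Rc ε s₀ * s⁻¹ ^ 6 := by
  have hs0 : 0 < s := lt_of_lt_of_le hs₀ hs
  have hsΘ : 0 < s ^ 2 * thetaSq θ ρ Rc ε s₀ := by positivity
  have hT2pos : 0 < T2 := lt_of_lt_of_le hsΘ hT2
  have h6 : (s ^ 2 * thetaSq θ ρ Rc ε s₀) ^ 6 ≤ T2 ^ 6 := pow_le_pow_left₀ hsΘ.le hT2 6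
  have h3 : (s ^ 2 * thetaSq θ ρ Rc ε s₀) ^ 3 ≤ T2 ^ 3 := pow_le_pow_left₀ hsΘ.le hT2 3
  have hs6 : s₀ ^ 6 ≤ s ^ 6 := pow_le_pow_left₀ hs₀.le hs 6
  have hA : thetaSq θ ρ Rc ε s₀ ^ 6 * s₀ ^ 6 * s ^ 6 ≤ T2 ^ 6 := by
    refine le_trans ?_ h6
    rw [show (s ^ 2 * thetaSq θ ρ Rc ε s₀) ^ 6 = thetaSq θ ρ Rc ε s₀ ^ 6 * s ^ 6 * s ^ 6 by ring]
    exact mul_le_mul_of_nonneg_right (mul_le_mul_of_nonneg_left hs6 (by positivity)) (by positivity)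
  have hB : thetaSq θ ρ Rc ε s₀ ^ 3 * s ^ 6 ≤ T2 ^ 3 := by
    refine le_trans (le_of_eq (by ring)) h3
  have i1 : 15 * (1 + ε) ^ 7 / (6 * T2 ^ 6) ≤ 15 * (1 + ε) ^ 7 / (6 * thetaSq θ ρ Rc ε s₀ ^ 6 * s₀ ^ 6) * s⁻¹ ^ 6 := by
    rw [inv_pow, ← div_eq_mul_inv, div_div]
    exact div_le_div_of_nonneg_left (by positivity) (by positivity) (by nlinarith)
  have i2 : 9 * (1 + ε) ^ 4 / (3 * T2 ^ 3) ≤ 9 * (1 + ε) ^ 4 / (3 * thetaSq θ ρ Rc ε s₀ ^ 3) * s⁻¹ ^ 6 := by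
    rw [inv_pow, ← div_eq_mul_inv, div_div]
    exact div_le_div_of_nonneg_left (by positivity) (by positivity) (by nlinarith)
  have hπ : π / sG ≤ π / g := div_le_div_of_nonneg_left Real.pi_pos.le hg hgs
  calc π / sG * (15 * (1 + ε) ^ 7 / (6 * T2 ^ 6) + 9 * (1 + ε) ^ 4 / (3 * T2 ^ 3))
      ≤ π / g * (15 * (1 + ε) ^ 7 / (6 * thetaSq θ ρ Rc ε s₀ ^ 6 * s₀ ^ 6) * s⁻¹ ^ 6 +
          9 * (1 + ε) ^ 4 / (3 * thetaSq θ ρ Rc ε s₀ ^ 3) * s⁻¹ ^ 6) :=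
        mul_le_mul hπ (add_le_add i1 i2) (by positivity) (by positivity)
    _ = sharpConst g θ ρ Rc ε s₀ * s⁻¹ ^ 6 := by unfold sharpConst; ring

/-! ## §3 Configuration level: the piecewise (crude below `s₀`, sharp from `s₀` on) span modulus from a height floor -/

/-- ★★ THE PIECEWISE SHARP MODULUS.  For independent periods `a, b ⊥ ν` (unit), a height floor `⟪ν, incr w i⟫ ≥ h₀ > ρ ≥ 0`, a Gram floor
`0 < g ≤ √G`, a cell radius `R_c`, `ε > 0`, `s₀ ≥ 1` with `Θ₂(h₀−ρ, ρ, R_c, ε, s₀) > 0`: the layer-pair forces are `τ`-Lipschitz along the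
`ρ`-tube with `τ_s = spanConst·s⁻⁶` (`s < s₀`, the crude `(v)` modulus) and `τ_s = sharpConst·s⁻⁶` (`s ≥ s₀`). -/
theorem isPairModulus_sharp {ν a b : E3} {w : ℤ → E3} {ρ h₀ g Rc ε : ℝ} {s₀ : ℕ} (hν : ‖ν‖ = 1) (hνa : ⟪ν, a⟫ = 0)
    (hνb : ⟪ν, b⟫ = 0) (hab : LinearIndependent ℝ ![a, b]) (hw : ∀ i, h₀ ≤ ⟪ν, incr w i⟫) (hρ0 : 0 ≤ ρ) (hρ : ρ < h₀)
    (hg : 0 < g) (hgG : g ≤ Real.sqrt (‖a‖ ^ 2 * ‖b‖ ^ 2 - ⟪a, b⟫ ^ 2)) (hε : 0 < ε) (hRc0 : 0 ≤ Rc)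
    (hRc : ∀ ζ₁ ζ₂ : ℝ, |ζ₁| ≤ 1 / 2 → |ζ₂| ≤ 1 / 2 → ‖ζ₁ • a + ζ₂ • b‖ ≤ Rc) (hs₀ : 1 ≤ s₀)
    (hΘ : 0 < thetaSq (h₀ - ρ) ρ Rc ε s₀) :
    IsPairModulus a b w ρ (fun s => if s < s₀ then spanConst (h₀ - ρ) (qA a b) (qB a b) * (s : ℝ)⁻¹ ^ 6
      else sharpConst g (h₀ - ρ) ρ Rc ε s₀ * (s : ℝ)⁻¹ ^ 6) := by
  intro k l hkl h h' hh hh'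
  have hθ : 0 < h₀ - ρ := sub_pos.2 hρ
  obtain ⟨n, hn⟩ : ∃ n : ℕ, (l - k).toNat = n := ⟨_, rfl⟩
  have hn1 : 1 ≤ n := by omega
  have hnZ : ((n : ℕ) : ℤ) = l - k := by omega
  have hnR : (n : ℝ) = ((l - k : ℤ) : ℝ) := by exact_mod_cast hnZ
  have hn0 : (0 : ℝ) < n := by exact_mod_cast (lt_of_lt_of_le Nat.one_pos hn1)
  rw [hn]; dsimp only
  by_cases hns : n < s₀
  · rw [if_pos hns]
    have := isPairModulus_of_heightFloor hν hνa hνb hab hw hρ k l hkl h h' hh hh'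
    rw [hn] at this; exact this
  · rw [if_neg hns]
    push Not at hns
    -- heights `⟪ν, offsetOf⟫ ≥ n (h₀ − ρ)`
    have hH : (n : ℝ) * (h₀ - ρ) ≤ ⟪ν, offsetOf h k l⟫ := by
      have := le_inner_offsetOf hν hh hw hkl.le; rwa [← hnR] at this
    have hH' : (n : ℝ) * (h₀ - ρ) ≤ ⟪ν, offsetOf h' k l⟫ := by
      have := le_inner_offsetOf hν hh' hw hkl.le; rwa [← hnR] at this
    have ht : 0 < (n : ℝ) * (h₀ - ρ) := by positivity
    have htv : ((n : ℝ) * (h₀ - ρ)) ^ 2 ≤ ⟪ν, -offsetOf h k l⟫ ^ 2 := by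
      rw [inner_neg_right, neg_sq]; exact pow_le_pow_left₀ ht.le hH 2
    have htv' : ((n : ℝ) * (h₀ - ρ)) ^ 2 ≤ ⟪ν, -offsetOf h' k l⟫ ^ 2 := by
      rw [inner_neg_right, neg_sq]; exact pow_le_pow_left₀ ht.le hH' 2
    -- planar discrepancy `‖v − v′‖ ≤ 2ρ n`
    have e : ‖-offsetOf h k l - -offsetOf h' k l‖ = ‖offsetOf h k l - offsetOf h' k l‖ := by
      rw [show -offsetOf h k l - -offsetOf h' k l = -(offsetOf h k l - offsetOf h' k l) by abel, norm_neg]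
    have hdist : ‖-offsetOf h k l - -offsetOf h' k l‖ ≤ 2 * ρ * n := by
      rw [e]
      refine (norm_offsetOf_sub_le h h' k l).trans ?_
      have hb : ∀ i ∈ Finset.Ioc k l, ‖h i - h' i‖ ≤ 2 * ρ := fun i _ => by
        have h1 : dist (h i) (incr w i) ≤ ρ := mem_closedBall.1 (hh i)
        have h2 : dist (h' i) (incr w i) ≤ ρ := mem_closedBall.1 (hh' i)
        rw [← dist_eq_norm]; linarith [dist_triangle_right (h i) (h' i) (incr w i)]
      refine (Finset.sum_le_card_nsmul _ _ _ hb).trans ?_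
      rw [Int.card_Ioc, hn, nsmul_eq_mul]
      exact le_of_eq (by ring)
    -- the sharp bound
    have hsR : (s₀ : ℝ) ≤ n := by exact_mod_cast hns
    have hs₀R : (0 : ℝ) < s₀ := by exact_mod_cast (lt_of_lt_of_le Nat.one_pos hs₀)
    have hT2 := sq_mul_thetaSq_le (Rc := Rc) hε hθ.le hρ0 hRc0 hs₀R hsR (le_refl ((n : ℝ) * (h₀ - ρ))) (norm_nonneg _) hdist
    have hTpos : 0 < (1 + ε) * ((n : ℝ) * (h₀ - ρ)) ^ 2 - (1 + ε⁻¹) * (‖-offsetOf h k l - -offsetOf h' k l‖ + Rc) ^ 2 :=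
      lt_of_lt_of_le (by positivity) hT2
    have key := norm_layerForce_sub_le_smear hν hνa hνb hab ht hε hRc hTpos htv htv' le_rfl
    have hK := smear_le_sharpConst hg hgG hε hs₀R hsR hΘ hT2
    calc _ ≤ _ := key
      _ ≤ sharpConst g (h₀ - ρ) ρ Rc ε s₀ * (n : ℝ)⁻¹ ^ 6 * ‖-offsetOf h k l - -offsetOf h' k l‖ :=
          mul_le_mul_of_nonneg_right hK (norm_nonneg _)
      _ = _ := by rw [e]

/-- ★★ PACKAGED at configuration level with the tail arithmetic: from a height floor `h₀ > 1/40` w.r.t. ANY unit normal `ν ⊥ a, b` on a uniformly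
clean stacked configuration with `‖a‖, ‖b‖ ≤ 17/16` (cell radius `R_c = 23/25`, Gram floor `g = 73/100` from `…HeightFloor.cleanStackedWindows`):
span moduli on the `1/40`-tube with `Σ_{s₀ ≤ s < N} s² τ_s ≤ sharpConst(73/100, h₀ − 1/40, 1/40, 23/25, ε, s₀)/(3(s₀−1)³)`. -/
theorem exists_tail_of_floor {a b ν : E3} {w' : ℤ → E3} {h₀ ε : ℝ} {s₀ : ℕ} (hst : IsStacked a b w') (hab : LinearIndependent ℝ ![a, b])
    (ha : ‖a‖ ≤ 17 / 16) (hb : ‖b‖ ≤ 17 / 16) (hUC : UniformlyClean (Layered a b w')) (hν : ‖ν‖ = 1) (hνa : ⟪ν, a⟫ = 0)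
    (hνb : ⟪ν, b⟫ = 0) (hw : ∀ i, h₀ ≤ ⟪ν, incr w' i⟫) (hρ : 1 / 40 < h₀) (hε : 0 < ε) (hs₀ : 2 ≤ s₀)
    (hΘ : 0 < thetaSq (h₀ - 1 / 40) (1 / 40) (23 / 25) ε s₀) :
    ∃ τ : ℕ → ℝ, (∀ s, 0 ≤ τ s) ∧
      (∀ N : ℕ, ∑ s ∈ Finset.Ico s₀ N, ((s : ℕ) : ℝ) ^ 2 * τ s ≤
        sharpConst (73 / 100) (h₀ - 1 / 40) (1 / 40) (23 / 25) ε s₀ / (3 * (((s₀ : ℕ) : ℝ) - 1) ^ 3)) ∧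
      IsPairModulus a b w' (1 / 40) τ := by
  obtain ⟨-, a', -, -, -, ha'lo, ha'hi, ⟨halo, hahi⟩, ⟨hblo, hbhi⟩, hp, -, -, hG, -, -⟩ := cleanStackedWindows hst hab ha hb hUC
  -- the Gram floor `√G ≥ 73/100`
  have hgG : (73 / 100 : ℝ) ≤ Real.sqrt (‖a‖ ^ 2 * ‖b‖ ^ 2 - ⟪a, b⟫ ^ 2) := by
    refine (Real.le_sqrt' (by norm_num)).2 ?_
    have h4 : (47 / 50 * (49 / 50) : ℝ) ^ 4 ≤ (a' * (49 / 50)) ^ 4 := pow_le_pow_left₀ (by norm_num) (by linarith) 4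
    nlinarith
  -- the cell radius `‖ζ₁ a + ζ₂ b‖ ≤ 23/25` for `|ζ₁|, |ζ₂| ≤ ½`
  have hRc : ∀ ζ₁ ζ₂ : ℝ, |ζ₁| ≤ 1 / 2 → |ζ₂| ≤ 1 / 2 → ‖ζ₁ • a + ζ₂ • b‖ ≤ 23 / 25 := by
    intro ζ₁ ζ₂ h₁ h₂
    have hsq : ‖ζ₁ • a + ζ₂ • b‖ ^ 2 ≤ (23 / 25) ^ 2 := by
      rw [norm_sq_lin]
      have hz1 : ζ₁ ^ 2 ≤ 1 / 4 := by have := abs_le.1 h₁; nlinarith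
      have hz2 : ζ₂ ^ 2 ≤ 1 / 4 := by have := abs_le.1 h₂; nlinarith
      have hz12 : |ζ₁ * ζ₂| ≤ 1 / 4 := by
        rw [abs_mul]; nlinarith [abs_nonneg ζ₁, abs_nonneg ζ₂]
      have hxa : ‖a‖ ^ 2 * ζ₁ ^ 2 ≤ ‖a‖ ^ 2 * (1 / 4) := mul_le_mul_of_nonneg_left hz1 (by positivity)
      have hyb : ‖b‖ ^ 2 * ζ₂ ^ 2 ≤ ‖b‖ ^ 2 * (1 / 4) := mul_le_mul_of_nonneg_left hz2 (by positivity)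
      have hpz : 2 * ⟪a, b⟫ * (ζ₁ * ζ₂) ≤ 2 * |⟪a, b⟫| * (1 / 4) := by
        have h1 := le_abs_self (⟪a, b⟫ * (ζ₁ * ζ₂))
        rw [abs_mul] at h1
        nlinarith [abs_nonneg ⟪a, b⟫]
      have hx : ‖a‖ ^ 2 ≤ (51 / 50) ^ 2 := pow_le_pow_left₀ (norm_nonneg _) (hahi.trans (by linarith)) 2
      have hy : ‖b‖ ^ 2 ≤ (51 / 50) ^ 2 := pow_le_pow_left₀ (norm_nonneg _) (hbhi.trans (by linarith)) 2
      have hc : (47 / 50 * (49 / 50) : ℝ) ^ 2 ≤ (a' * (49 / 50)) ^ 2 := pow_le_pow_left₀ (by norm_num) (by linarith) 2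
      nlinarith [abs_nonneg ⟪a, b⟫]
    exact (pow_le_pow_iff_left₀ (norm_nonneg _) (by norm_num) two_ne_zero).1 hsq
  have hPM := isPairModulus_sharp hν hνa hνb hab hw (by norm_num) hρ (by norm_num : (0:ℝ) < 73 / 100) hgG hε
    (by norm_num : (0:ℝ) ≤ 23 / 25) hRc (by omega) hΘ
  have hK0 : 0 ≤ sharpConst (73 / 100) (h₀ - 1 / 40) (1 / 40) (23 / 25) ε s₀ :=
    sharpConst_nonneg (by norm_num) hε (by exact_mod_cast (by omega : 0 < s₀)) hΘ
  refine ⟨_, fun s => ?_, fun N => ?_, hPM⟩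
  · split_ifs
    · exact mul_nonneg (spanConst_nonneg _ _ _) (by positivity)
    · exact mul_nonneg hK0 (by positivity)
  · refine (Finset.sum_congr rfl fun s hs => ?_).trans_le (sum_Ico_sq_mul_power_le hK0 hs₀ N)
    rw [if_neg (not_lt.2 (Finset.mem_Ico.1 hs).1)]

-- landing note (hand-2 g12): lens-3 g25 (c) PairModulusSharp e02039b2 (485 l) PRE-SPLIT for the gate's 400-line rule; the remaining sections continue,
-- byte-identical and in the same namespace, in `ChartedPlanarOrderPairModulusSharpB`.

end Summit.AtomisticToContinuum.Crystallization.Theorems.ChartedPlanarOrderPairModulusSharp
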